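import Summits.ABC.IUTFork.Conditional.AbcOfSGenuineKTameRobustTate
import HarnessLib

/-!
# R-W table rows DECIDED (refuted side, S_H level) UNCONDITIONALLY below the prime floor `30·l + 2` by the TATE-EXACT local type — part 5:
# the triple `2¹²·13³·223³ + 3¹⁵·11³·97⁵·409 = 5¹⁵·179⁴·2141` at `l = 7, 11, 13` (pole prime `p = 97`, `v_p(abc) = 5`, `e(u | 97) ∣ 6·l`)

PROOF-ONLY file (no `def`, no new `Prop`, no instance) of the abc-iut cell (seat abc-iut-W-ref-2, gen 0; director-abc g3 MINT-LIST BATCH 1, ROW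
«TARGETS.tsv kind TE rows 26–51», TARGETS.tsv sha16 043f473bc4159fa7). Sequel of this seat's `AbcOfSGenuineKTameRobustTate` p465202, whose
`GenuineK.not_pilotKummerCompatHull_chosen_triple_of_six_top` (`5 ∣ v_p(abc)` ⇒ every place `u | p` of `T.K` has `e(u | p) ∣ 6·l`, prime floor
`6·l + 2`; abc-iut-w5-d107's robust tame-exact decider p459701 + the Tate-exact local type p464241/p464995 — Serre 1972 n° 1.12: `E[5]` is UNRAMIFIED
at a multiplicative place with `5 ∣ ord Δ_min`, proved in the tree from Kodaira–Néron) is instantiated at the ONE datum of HOME/plan/rescue/R-W/TARGETS.tsv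
left undecided at `l ∈ {7, 11, 13}` by abc-iut-w5-d107's `…TameRobustRows1–4` (floor `30·l + 2`) and `…LinUniformRows1–6` (HOME/STATUS 2026-08-26T19:39:36Z:
«14 pairs remain … 2¹²13³223³ @ 7/11/13/29»): the de Smit triple `2¹²·13³·223³ + 3¹⁵·11³·97⁵·409 = 5¹⁵·179⁴·2141` read at its pole prime `p = 97`
(`97⁵ ∥ abc`, `5 ∣ 5`, `6·13 + 2 = 80 ≤ 97`; top labels `j = 3, 5, 6`: `2l ≤ (l−3)·5` for `l = 7, 11, 13`). This decides the table's (datum, l) pairs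
`pilotDataOfK:frey-99794037551104-67077806999235503464521-67077807099029541015625:7 / :11 / :13` — TE rows 4, 6 (`l = 7`), 12, 16, 18 (`l = 11`),
24, 26 (`l = 13`) and the LIN/RAD/U2cell rows 57, 61, 81, 87, 115, 124, 152 of the same pairs (the kernel statement depends on (datum, l) only, not on
the refuting prime); the pair at `l = 29` (rows 263, 264, 268) is NOT reached (`6·29 + 2 > 97`; at `p = 223`, `v = 3`: `10·29 + 2 > 223`; at `p = 179`,
`v = 4`: `3, 5 ∤ 4`). TAKES NO SIDE on [IUTchIII] Cor. 3.12 or on any author. Inputs per `l` are integer facts checked by `norm_num`.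
The theorem: for each listed `l` and EVERY genuine Θ-volume datum `T` over `(ratPoint (a/c), l)` the hull-level clause S_H (chosen realising ideles, pinned
reading — the per-datum object of the window binders `hSHw`/`hSHwBad`) FAILS for every choice of the free context binders and Kummer datum. NOT claimed:
admissibility / Szpiro-badness / (P6) of `(ratPoint (a/c), l)` and non-emptiness of the datum type. HONEST SCOPE as in the parents: SHARP reading;
per-label licence STRONGER than print; «refuted as typed» ≠ «refuted in print»; nothing about the number-level Corollary; typed ≠ proved; instantiated
≠ endorsed. [cite: Mochizuki2012, IUTchIII Cor. 3.12 Step (xi-f) p. 184; IUTchIV Thm. 1.10 proof Steps (ii)–(iii) p. 24–26, Cor. 2.2 (ii) proof p. 44]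
[cite: Serre1972, §1.11–§1.12] [cite: MochizukiGenEll2010, Thm. 2.1 p. 11] [claim: Mochizuki2012, status: disputed] for every IUT sentence quoted.
-/

noncomputable section

open Set Function NumberField IsDedekindDomain

namespace Summit.ABC.IUTFork.Conditional

open Thm311 Thm311.Real Cor312 Cor312Vol Cor312Prov Literature.IUT.LogThetaLattice Literature.IUT.LogVolume
  Literature.IUT.HodgeTheaters Literature.IUT.LogVolume.ThetaData Literature.IUT.LogVolume.Cor22
open Literature.NumberTheory.NumberFields Literature.NumberTheory.GaloisRepresentations.Ultrametric
open Literature.NumberTheory.DiophantineGeometry Literature.NumberTheory.DiophantineGeometry.GenEll Summit.ABC.ABC.Theorems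

/-- The known abc triple `2¹²·13³·223³ + 3¹⁵·11³·97⁵·409 = 5¹⁵·179⁴·2141` (de Smit's table; R-W numerics, HOME/plan/rescue/R-W/TARGETS.tsv datum
`pilotDataOfK:frey-99794037551104-67077806999235503464521-67077807099029541015625`). [folklore] -/
theorem isABCTriple_frey99794037551104 : IsABCTriple (2 ^ 12 * 13 ^ 3 * 223 ^ 3) (3 ^ 15 * 11 ^ 3 * 97 ^ 5 * 409) (5 ^ 15 * 179 ^ 4 * 2141) := by
  refine ⟨by norm_num, by norm_num, by norm_num, ?_⟩
  rw [Nat.coprime_iff_gcd_eq_one]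
  norm_num

/-- **R-W ROWS `pilotDataOfK:frey-99794037551104-67077806999235503464521-67077807099029541015625` at `:7`, `:11`, `:13` — REFUTED side, UNCONDITIONALLY**
(TARGETS.tsv TE rows 4, 6 / 12, 16, 18 / 24, 26, «ALL e»; Szpiro margins −5.90 / −28.86 / −31.88): triple `2¹²·13³·223³ + 3¹⁵·11³·97⁵·409 = 5¹⁵·179⁴·2141`,
deciding packet the pole prime `p = 97` (`v_p(abc) = 5`, `5 ∣ 5`, so every place `u | 97` of `T.K` has `e(u | 97) ∣ 6·l ≤ 78 ≤ 95` — the table's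
«genuine e_w ∈ {3l, 6l}»; `97 ∉ {2, 3, 5, l}`; `6·l + 2 ≤ 97`), top label `j = l⋆` (`2l ≤ (l−3)·5`): S_H FAILS at every genuine Θ-volume datum over
`(ratPoint (a/c), l)` for each listed `l`, every choice of the free binders. [cite: Mochizuki2012, IUTchIII Cor. 3.12 Step (xi-f) p. 184]
[cite: Serre1972, §1.11–§1.12] [claim: Mochizuki2012, status: disputed] -/
theorem GenuineK.not_pilotKummerCompatHull_chosen_frey99794037551104 {l : ℕ} (hl : l = 7 ∨ l = 11 ∨ l = 13)
    (T : Cor22.ThetaVolumeDatumAt (ratPoint (((2 ^ 12 * 13 ^ 3 * 223 ^ 3 : ℕ) : ℚ) / (5 ^ 15 * 179 ^ 4 * 2141 : ℕ))) l) :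
    letI := T.instFieldF; letI := T.instNumberFieldF; letI := T.instAlgebraF; letI := T.instFieldK
    letI := T.instNumberFieldK; letI := T.instAlgebraK; letI := T.instFieldFbar; letI := T.instAlgebraFbar
    letI := T.instAlgebraKFbar; letI := T.instIsElliptic
    ∀ (M : Type) [Field M] [NumberField M]
      (archPk : ∀ (j : (thetaIndex (pilotDataOfK T.D T.K)).Label) (vQ : (thetaIndex (pilotDataOfK T.D T.K)).VQ),
        Set ((logShellsDH (pilotDataOfK T.D T.K) (analyticLogv T.K)).Packet j vQ))
      (archSub : ∀ (j : (thetaIndex (pilotDataOfK T.D T.K)).Label) (v : (thetaIndex (pilotDataOfK T.D T.K)).V),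
        Set ((logShellsDH (pilotDataOfK T.D T.K) (analyticLogv T.K)).Packet j ((thetaIndex (pilotDataOfK T.D T.K)).over v)))
      (Ψ : ℤ → ∀ v : (thetaIndex (pilotDataOfK T.D T.K)).V, v ∈ (thetaIndex (pilotDataOfK T.D T.K)).Vbad →
        Set ((logShellsDH (pilotDataOfK T.D T.K) (analyticLogv T.K)).StarPacket v))
      (act : ℤ → ∀ v : (thetaIndex (pilotDataOfK T.D T.K)).V, v ∈ (thetaIndex (pilotDataOfK T.D T.K)).Vbad →
        (logShellsDH (pilotDataOfK T.D T.K) (analyticLogv T.K)).StarPacket v →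
          Module.End ℚ ((logShellsDH (pilotDataOfK T.D T.K) (analyticLogv T.K)).StarPacket v))
      (Mmod : ℤ → ∀ j : (thetaIndex (pilotDataOfK T.D T.K)).LabelStar, Set ((logShellsDH (pilotDataOfK T.D T.K) (analyticLogv T.K)).GlobalPacket j.1))
      (region : ℤ → ∀ j : (thetaIndex (pilotDataOfK T.D T.K)).LabelStar, FinDivisor M → ∀ vQ : (thetaIndex (pilotDataOfK T.D T.K)).VQ,
        Set ((logShellsDH (pilotDataOfK T.D T.K) (analyticLogv T.K)).Packet j.1 vQ))
      (frobAdm : ℤ → ℤ → ∀ (j : (thetaIndex (pilotDataOfK T.D T.K)).Label) (vQ : (thetaIndex (pilotDataOfK T.D T.K)).VQ),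
        Set ((logShellsDH (pilotDataOfK T.D T.K) (analyticLogv T.K)).Packet j vQ) → Prop)
      (frobLogvol : ℤ → ℤ → ∀ (j : (thetaIndex (pilotDataOfK T.D T.K)).Label) (vQ : (thetaIndex (pilotDataOfK T.D T.K)).VQ),
        Set ((logShellsDH (pilotDataOfK T.D T.K) (analyticLogv T.K)).Packet j vQ) → ℝ)
      (frobΨ : ℤ → ℤ → ∀ v : (thetaIndex (pilotDataOfK T.D T.K)).V, v ∈ (thetaIndex (pilotDataOfK T.D T.K)).Vbad →
        Set ((logShellsDH (pilotDataOfK T.D T.K) (analyticLogv T.K)).StarPacket v))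
      (frobMmod : ℤ → ℤ → ∀ j : (thetaIndex (pilotDataOfK T.D T.K)).LabelStar, Set ((logShellsDH (pilotDataOfK T.D T.K) (analyticLogv T.K)).GlobalPacket j.1))
      (unitImage : ℤ → ℤ → ℕ → ∀ (j : (thetaIndex (pilotDataOfK T.D T.K)).Label) (vQ : (thetaIndex (pilotDataOfK T.D T.K)).VQ),
        Set ((logShellsDH (pilotDataOfK T.D T.K) (analyticLogv T.K)).Packet j vQ))
      (ballImage : ℤ → ℤ → ∀ (j : (thetaIndex (pilotDataOfK T.D T.K)).Label) (vQ : (thetaIndex (pilotDataOfK T.D T.K)).VQ),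
        Set ((logShellsDH (pilotDataOfK T.D T.K) (analyticLogv T.K)).Packet j vQ))
      (thetaDiv : ℤ → ℤ → LgpDivisor M (thetaIndex (pilotDataOfK T.D T.K)).lstar)
      (n : ℤ) {HT : Type} {LogLink : HT → HT → Type} {IsFull : ∀ {s t : HT}, LogLink s t → Prop}
      (lat : LGPGaussianLogThetaLattice LogLink IsFull)
      {Frd : Type} {IsoF : Frd → Frd → Type} {Ob : Frd → Type} {realify : Frd → Frd} {Strip : Type}
      {IsoS : Strip → Strip → Type} {Mv : ∀ v : (thetaIndex (pilotDataOfK T.D T.K)).V, v ∈ (thetaIndex (pilotDataOfK T.D T.K)).Vbad → Type}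
      [∀ v h, Monoid (Mv v h)]
      (sig : GlobalLGPFrobenioidSignature (thetaIndex (pilotDataOfK T.D T.K)).lstar (thetaIndex (pilotDataOfK T.D T.K)).V
        (· ∈ (thetaIndex (pilotDataOfK T.D T.K)).Vbad) Frd IsoF Ob realify Strip IsoS Mv)
      (split : SplittingMonoids Mv) {ObΔ : Type} {N : ∀ v : (thetaIndex (pilotDataOfK T.D T.K)).V, v ∈ (thetaIndex (pilotDataOfK T.D T.K)).Vbad → Type}
      [∀ v h, Monoid (N v h)] (qData : QPilotData ObΔ N)
      (qK : ∀ v : (thetaIndex (pilotDataOfK T.D T.K)).V, v ∈ (thetaIndex (pilotDataOfK T.D T.K)).Vbad →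
        Set ((logShellsDH (pilotDataOfK T.D T.K) (analyticLogv T.K)).StarPacket v)),
      ¬ Cor312Vol.PilotKummerCompatHull
          (LatticeSituation.ofShells (logShellsDH (pilotDataOfK T.D T.K) (analyticLogv T.K)) M archPk archSub
            (summandPiecesPr (pilotDataOfK T.D T.K) (logvAnalytic_analyticLogv (F := T.K))).Adm
            (summandPiecesPr (pilotDataOfK T.D T.K) (logvAnalytic_analyticLogv (F := T.K))).logvol Ψ act Mmod region frobAdm frobLogvol frobΨ
            frobMmod unitImage ballImage thetaDiv)
          (settingPrVolSharp (pilotDataOfK T.D T.K) (logvAnalytic_analyticLogv (F := T.K)) M archPk archSub Ψ act Mmod region n lat sig split qData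
            (exists_realising_qIdeles_pilotDataOfK T.D).choose (exists_realising_thetaIdeles_pilotDataOfK T.D).choose
            (exists_realising_qIdeles_pilotDataOfK T.D).choose_spec.1 (exists_realising_qIdeles_pilotDataOfK T.D).choose_spec.2.1)
          (fun _ => Cor312.Setting.qRegion
            (settingPrVolSharp (pilotDataOfK T.D T.K) (logvAnalytic_analyticLogv (F := T.K)) M archPk archSub Ψ act Mmod region n lat sig split qData
              (exists_realising_qIdeles_pilotDataOfK T.D).choose (exists_realising_thetaIdeles_pilotDataOfK T.D).choose
              (exists_realising_qIdeles_pilotDataOfK T.D).choose_spec.1 (exists_realising_qIdeles_pilotDataOfK T.D).choose_spec.2.1)) qK := by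
  rcases hl with rfl | rfl | rfl
  · exact GenuineK.not_pilotKummerCompatHull_chosen_triple_of_six_top isABCTriple_frey99794037551104 T ⟨97, by norm_num⟩ (by norm_num)
      (by norm_num) (by norm_num) (by norm_num) (by norm_num) 5 (by norm_num) (dvd_mul_of_dvd_left (dvd_mul_of_dvd_right (by norm_num) _) _)
      (by norm_num) (by norm_num) (by norm_num)
  · exact GenuineK.not_pilotKummerCompatHull_chosen_triple_of_six_top isABCTriple_frey99794037551104 T ⟨97, by norm_num⟩ (by norm_num)
      (by norm_num) (by norm_num) (by norm_num) (by norm_num) 5 (by norm_num) (dvd_mul_of_dvd_left (dvd_mul_of_dvd_right (by norm_num) _) _)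
      (by norm_num) (by norm_num) (by norm_num)
  · exact GenuineK.not_pilotKummerCompatHull_chosen_triple_of_six_top isABCTriple_frey99794037551104 T ⟨97, by norm_num⟩ (by norm_num)
      (by norm_num) (by norm_num) (by norm_num) (by norm_num) 5 (by norm_num) (dvd_mul_of_dvd_left (dvd_mul_of_dvd_right (by norm_num) _) _)
      (by norm_num) (by norm_num) (by norm_num)

/-- **R-W ROW 26 `pilotDataOfK:frey-99794037551104-67077806999235503464521-67077807099029541015625:13` read at its OWN packet `p = 223`** (TARGETS.tsv
TE row 26: `l = 13`, `p = 223`, `v_p(abc) = 3`, genuine `e_w ∈ {65, 130}`, refuting label `j = 6`, margin −31.878757) — the row's own certificate: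
`3 ∣ 3`, so every `u | 223` of `T.K` has `e(u | 223) ∣ 10·13 = 130 ≤ 221` (`…_triple_of_ten_top`, floor `10·13 + 2 = 132 ≤ 223`, `26 ≤ 30`).
Same kernel statement as the `l = 13` case above (the statement depends on (datum, l) only). [cite: Mochizuki2012, IUTchIII Cor. 3.12 Step (xi-f) p. 184]
[cite: Serre1972, §1.11–§1.12] [claim: Mochizuki2012, status: disputed] -/
theorem GenuineK.not_pilotKummerCompatHull_chosen_triple_223_thirteen
    (T : Cor22.ThetaVolumeDatumAt (ratPoint (((2 ^ 12 * 13 ^ 3 * 223 ^ 3 : ℕ) : ℚ) / (5 ^ 15 * 179 ^ 4 * 2141 : ℕ))) 13) :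
    letI := T.instFieldF; letI := T.instNumberFieldF; letI := T.instAlgebraF; letI := T.instFieldK
    letI := T.instNumberFieldK; letI := T.instAlgebraK; letI := T.instFieldFbar; letI := T.instAlgebraFbar
    letI := T.instAlgebraKFbar; letI := T.instIsElliptic
    ∀ (M : Type) [Field M] [NumberField M]
      (archPk : ∀ (j : (thetaIndex (pilotDataOfK T.D T.K)).Label) (vQ : (thetaIndex (pilotDataOfK T.D T.K)).VQ),
        Set ((logShellsDH (pilotDataOfK T.D T.K) (analyticLogv T.K)).Packet j vQ))
      (archSub : ∀ (j : (thetaIndex (pilotDataOfK T.D T.K)).Label) (v : (thetaIndex (pilotDataOfK T.D T.K)).V),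
        Set ((logShellsDH (pilotDataOfK T.D T.K) (analyticLogv T.K)).Packet j ((thetaIndex (pilotDataOfK T.D T.K)).over v)))
      (Ψ : ℤ → ∀ v : (thetaIndex (pilotDataOfK T.D T.K)).V, v ∈ (thetaIndex (pilotDataOfK T.D T.K)).Vbad →
        Set ((logShellsDH (pilotDataOfK T.D T.K) (analyticLogv T.K)).StarPacket v))
      (act : ℤ → ∀ v : (thetaIndex (pilotDataOfK T.D T.K)).V, v ∈ (thetaIndex (pilotDataOfK T.D T.K)).Vbad →
        (logShellsDH (pilotDataOfK T.D T.K) (analyticLogv T.K)).StarPacket v →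
          Module.End ℚ ((logShellsDH (pilotDataOfK T.D T.K) (analyticLogv T.K)).StarPacket v))
      (Mmod : ℤ → ∀ j : (thetaIndex (pilotDataOfK T.D T.K)).LabelStar, Set ((logShellsDH (pilotDataOfK T.D T.K) (analyticLogv T.K)).GlobalPacket j.1))
      (region : ℤ → ∀ j : (thetaIndex (pilotDataOfK T.D T.K)).LabelStar, FinDivisor M → ∀ vQ : (thetaIndex (pilotDataOfK T.D T.K)).VQ,
        Set ((logShellsDH (pilotDataOfK T.D T.K) (analyticLogv T.K)).Packet j.1 vQ))
      (frobAdm : ℤ → ℤ → ∀ (j : (thetaIndex (pilotDataOfK T.D T.K)).Label) (vQ : (thetaIndex (pilotDataOfK T.D T.K)).VQ),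
        Set ((logShellsDH (pilotDataOfK T.D T.K) (analyticLogv T.K)).Packet j vQ) → Prop)
      (frobLogvol : ℤ → ℤ → ∀ (j : (thetaIndex (pilotDataOfK T.D T.K)).Label) (vQ : (thetaIndex (pilotDataOfK T.D T.K)).VQ),
        Set ((logShellsDH (pilotDataOfK T.D T.K) (analyticLogv T.K)).Packet j vQ) → ℝ)
      (frobΨ : ℤ → ℤ → ∀ v : (thetaIndex (pilotDataOfK T.D T.K)).V, v ∈ (thetaIndex (pilotDataOfK T.D T.K)).Vbad →
        Set ((logShellsDH (pilotDataOfK T.D T.K) (analyticLogv T.K)).StarPacket v))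
      (frobMmod : ℤ → ℤ → ∀ j : (thetaIndex (pilotDataOfK T.D T.K)).LabelStar, Set ((logShellsDH (pilotDataOfK T.D T.K) (analyticLogv T.K)).GlobalPacket j.1))
      (unitImage : ℤ → ℤ → ℕ → ∀ (j : (thetaIndex (pilotDataOfK T.D T.K)).Label) (vQ : (thetaIndex (pilotDataOfK T.D T.K)).VQ),
        Set ((logShellsDH (pilotDataOfK T.D T.K) (analyticLogv T.K)).Packet j vQ))
      (ballImage : ℤ → ℤ → ∀ (j : (thetaIndex (pilotDataOfK T.D T.K)).Label) (vQ : (thetaIndex (pilotDataOfK T.D T.K)).VQ),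
        Set ((logShellsDH (pilotDataOfK T.D T.K) (analyticLogv T.K)).Packet j vQ))
      (thetaDiv : ℤ → ℤ → LgpDivisor M (thetaIndex (pilotDataOfK T.D T.K)).lstar)
      (n : ℤ) {HT : Type} {LogLink : HT → HT → Type} {IsFull : ∀ {s t : HT}, LogLink s t → Prop}
      (lat : LGPGaussianLogThetaLattice LogLink IsFull)
      {Frd : Type} {IsoF : Frd → Frd → Type} {Ob : Frd → Type} {realify : Frd → Frd} {Strip : Type}
      {IsoS : Strip → Strip → Type} {Mv : ∀ v : (thetaIndex (pilotDataOfK T.D T.K)).V, v ∈ (thetaIndex (pilotDataOfK T.D T.K)).Vbad → Type}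
      [∀ v h, Monoid (Mv v h)]
      (sig : GlobalLGPFrobenioidSignature (thetaIndex (pilotDataOfK T.D T.K)).lstar (thetaIndex (pilotDataOfK T.D T.K)).V
        (· ∈ (thetaIndex (pilotDataOfK T.D T.K)).Vbad) Frd IsoF Ob realify Strip IsoS Mv)
      (split : SplittingMonoids Mv) {ObΔ : Type} {N : ∀ v : (thetaIndex (pilotDataOfK T.D T.K)).V, v ∈ (thetaIndex (pilotDataOfK T.D T.K)).Vbad → Type}
      [∀ v h, Monoid (N v h)] (qData : QPilotData ObΔ N)
      (qK : ∀ v : (thetaIndex (pilotDataOfK T.D T.K)).V, v ∈ (thetaIndex (pilotDataOfK T.D T.K)).Vbad →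
        Set ((logShellsDH (pilotDataOfK T.D T.K) (analyticLogv T.K)).StarPacket v)),
      ¬ Cor312Vol.PilotKummerCompatHull
          (LatticeSituation.ofShells (logShellsDH (pilotDataOfK T.D T.K) (analyticLogv T.K)) M archPk archSub
            (summandPiecesPr (pilotDataOfK T.D T.K) (logvAnalytic_analyticLogv (F := T.K))).Adm
            (summandPiecesPr (pilotDataOfK T.D T.K) (logvAnalytic_analyticLogv (F := T.K))).logvol Ψ act Mmod region frobAdm frobLogvol frobΨ
            frobMmod unitImage ballImage thetaDiv)
          (settingPrVolSharp (pilotDataOfK T.D T.K) (logvAnalytic_analyticLogv (F := T.K)) M archPk archSub Ψ act Mmod region n lat sig split qData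
            (exists_realising_qIdeles_pilotDataOfK T.D).choose (exists_realising_thetaIdeles_pilotDataOfK T.D).choose
            (exists_realising_qIdeles_pilotDataOfK T.D).choose_spec.1 (exists_realising_qIdeles_pilotDataOfK T.D).choose_spec.2.1)
          (fun _ => Cor312.Setting.qRegion
            (settingPrVolSharp (pilotDataOfK T.D T.K) (logvAnalytic_analyticLogv (F := T.K)) M archPk archSub Ψ act Mmod region n lat sig split qData
              (exists_realising_qIdeles_pilotDataOfK T.D).choose (exists_realising_thetaIdeles_pilotDataOfK T.D).choose
              (exists_realising_qIdeles_pilotDataOfK T.D).choose_spec.1 (exists_realising_qIdeles_pilotDataOfK T.D).choose_spec.2.1)) qK :=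
  GenuineK.not_pilotKummerCompatHull_chosen_triple_of_ten_top isABCTriple_frey99794037551104 T ⟨223, by norm_num⟩ (by norm_num) (by norm_num)
    (by norm_num) (by norm_num) (by norm_num) 3 (by norm_num) (dvd_mul_of_dvd_left (dvd_mul_of_dvd_left (by norm_num) _) _) (by norm_num)
    (by norm_num) (by norm_num)

/-- **The de Smit triple `2¹²·13³·223³ + 3¹⁵·11³·97⁵·409 = 5¹⁵·179⁴·2141` at EVERY `l` its two lattice-tame pole packets reach by the TATE-EXACT
local type: `l ∈ {7, 11, 13, 17, 19}` — REFUTED side, UNCONDITIONALLY** (abc-iut-W-ref-2 gen 2, authors-first completion of this file's datum).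
R-W numerics context (HOME/plan/rescue/R-W/TE30-CENSUS.tsv v2 sha16 4aacf04dd720d649, N3 = 57 known triples × every admissible `l`): among the
2,158 Szpiro-bad admissible (triple, l) pairs of N3, exactly 131 are decidable by this seat's Tate-exact engine (`…_triple_of_ten_top`: heavy pole
prime `p ∉ {2,3,5,l}`, `3 ∣ v_p(abc)`, `p ≥ 10·l + 2`; `…_triple_of_six_top`: `5 ∣ v_p(abc)`, `p ≥ 6·l + 2`), and exactly FIVE of those by NEITHER
the floor-`30·l + 2` tame decider (column `te30_decidable`) NOR abc-iut-w5-d107's e-free LIN-uniform decider p464182 (column `linu_decidable`) —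
all five at this datum: `l = 7, 11, 13` (the theorem `…_frey99794037551104` above, pole prime `97`, `v = 5`) and **`l = 17, 19`** (census rows
`frey-2^12*13^3*223^3+… @ 17 / @ 19`: Szpiro margins −34.67 / −35.19, admissible, `te30 N`, `linu N`), decided HERE at the pole prime `p = 223`
(`223³ ∥ abc`, `3 ∣ 3`, so every place `u | 223` of `T.K` has `e(u | 223) ∣ 10·l ≤ 190 ≤ 221`; floor `10·19 + 2 = 192 ≤ 223`; top label
`j = l⋆`: `2·17 ≤ 14·3`, `2·19 ≤ 16·3`). Not reached by any lattice-tame packet of this triple: `l = 23` and beyond at `p = 223` (`10·23 + 2 > 223`),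
which the LIN-uniform column decides at `p = 97` from `l = 23` on (abc-iut-w6-d108's row file for `l = 29`). For each listed `l` and EVERY genuine
Θ-volume datum `T` over `(ratPoint (a/c), l)`: S_H (chosen realising ideles, pinned reading) FAILS for every choice of the free binders. NOT claimed:
admissibility / Szpiro-badness / (P6) / non-emptiness of the datum type; «refuted as typed» ≠ «refuted in print»; nothing about the number-level
Corollary; typed ≠ proved. [cite: Mochizuki2012, IUTchIII Cor. 3.12 Step (xi-f) p. 184; IUTchIV Cor. 2.2 (ii) proof p. 44]
[cite: Serre1972, §1.11–§1.12] [claim: Mochizuki2012, status: disputed] -/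
theorem GenuineK.not_pilotKummerCompatHull_chosen_frey99794037551104_tate {l : ℕ}
    (hl : l = 7 ∨ l = 11 ∨ l = 13 ∨ l = 17 ∨ l = 19)
    (T : Cor22.ThetaVolumeDatumAt (ratPoint (((2 ^ 12 * 13 ^ 3 * 223 ^ 3 : ℕ) : ℚ) / (5 ^ 15 * 179 ^ 4 * 2141 : ℕ))) l) :
    letI := T.instFieldF; letI := T.instNumberFieldF; letI := T.instAlgebraF; letI := T.instFieldK
    letI := T.instNumberFieldK; letI := T.instAlgebraK; letI := T.instFieldFbar; letI := T.instAlgebraFbar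
    letI := T.instAlgebraKFbar; letI := T.instIsElliptic
    ∀ (M : Type) [Field M] [NumberField M]
      (archPk : ∀ (j : (thetaIndex (pilotDataOfK T.D T.K)).Label) (vQ : (thetaIndex (pilotDataOfK T.D T.K)).VQ),
        Set ((logShellsDH (pilotDataOfK T.D T.K) (analyticLogv T.K)).Packet j vQ))
      (archSub : ∀ (j : (thetaIndex (pilotDataOfK T.D T.K)).Label) (v : (thetaIndex (pilotDataOfK T.D T.K)).V),
        Set ((logShellsDH (pilotDataOfK T.D T.K) (analyticLogv T.K)).Packet j ((thetaIndex (pilotDataOfK T.D T.K)).over v)))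
      (Ψ : ℤ → ∀ v : (thetaIndex (pilotDataOfK T.D T.K)).V, v ∈ (thetaIndex (pilotDataOfK T.D T.K)).Vbad →
        Set ((logShellsDH (pilotDataOfK T.D T.K) (analyticLogv T.K)).StarPacket v))
      (act : ℤ → ∀ v : (thetaIndex (pilotDataOfK T.D T.K)).V, v ∈ (thetaIndex (pilotDataOfK T.D T.K)).Vbad →
        (logShellsDH (pilotDataOfK T.D T.K) (analyticLogv T.K)).StarPacket v →
          Module.End ℚ ((logShellsDH (pilotDataOfK T.D T.K) (analyticLogv T.K)).StarPacket v))
      (Mmod : ℤ → ∀ j : (thetaIndex (pilotDataOfK T.D T.K)).LabelStar, Set ((logShellsDH (pilotDataOfK T.D T.K) (analyticLogv T.K)).GlobalPacket j.1))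
      (region : ℤ → ∀ j : (thetaIndex (pilotDataOfK T.D T.K)).LabelStar, FinDivisor M → ∀ vQ : (thetaIndex (pilotDataOfK T.D T.K)).VQ,
        Set ((logShellsDH (pilotDataOfK T.D T.K) (analyticLogv T.K)).Packet j.1 vQ))
      (frobAdm : ℤ → ℤ → ∀ (j : (thetaIndex (pilotDataOfK T.D T.K)).Label) (vQ : (thetaIndex (pilotDataOfK T.D T.K)).VQ),
        Set ((logShellsDH (pilotDataOfK T.D T.K) (analyticLogv T.K)).Packet j vQ) → Prop)
      (frobLogvol : ℤ → ℤ → ∀ (j : (thetaIndex (pilotDataOfK T.D T.K)).Label) (vQ : (thetaIndex (pilotDataOfK T.D T.K)).VQ),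
        Set ((logShellsDH (pilotDataOfK T.D T.K) (analyticLogv T.K)).Packet j vQ) → ℝ)
      (frobΨ : ℤ → ℤ → ∀ v : (thetaIndex (pilotDataOfK T.D T.K)).V, v ∈ (thetaIndex (pilotDataOfK T.D T.K)).Vbad →
        Set ((logShellsDH (pilotDataOfK T.D T.K) (analyticLogv T.K)).StarPacket v))
      (frobMmod : ℤ → ℤ → ∀ j : (thetaIndex (pilotDataOfK T.D T.K)).LabelStar, Set ((logShellsDH (pilotDataOfK T.D T.K) (analyticLogv T.K)).GlobalPacket j.1))
      (unitImage : ℤ → ℤ → ℕ → ∀ (j : (thetaIndex (pilotDataOfK T.D T.K)).Label) (vQ : (thetaIndex (pilotDataOfK T.D T.K)).VQ),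
        Set ((logShellsDH (pilotDataOfK T.D T.K) (analyticLogv T.K)).Packet j vQ))
      (ballImage : ℤ → ℤ → ∀ (j : (thetaIndex (pilotDataOfK T.D T.K)).Label) (vQ : (thetaIndex (pilotDataOfK T.D T.K)).VQ),
        Set ((logShellsDH (pilotDataOfK T.D T.K) (analyticLogv T.K)).Packet j vQ))
      (thetaDiv : ℤ → ℤ → LgpDivisor M (thetaIndex (pilotDataOfK T.D T.K)).lstar)
      (n : ℤ) {HT : Type} {LogLink : HT → HT → Type} {IsFull : ∀ {s t : HT}, LogLink s t → Prop}
      (lat : LGPGaussianLogThetaLattice LogLink IsFull)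
      {Frd : Type} {IsoF : Frd → Frd → Type} {Ob : Frd → Type} {realify : Frd → Frd} {Strip : Type}
      {IsoS : Strip → Strip → Type} {Mv : ∀ v : (thetaIndex (pilotDataOfK T.D T.K)).V, v ∈ (thetaIndex (pilotDataOfK T.D T.K)).Vbad → Type}
      [∀ v h, Monoid (Mv v h)]
      (sig : GlobalLGPFrobenioidSignature (thetaIndex (pilotDataOfK T.D T.K)).lstar (thetaIndex (pilotDataOfK T.D T.K)).V
        (· ∈ (thetaIndex (pilotDataOfK T.D T.K)).Vbad) Frd IsoF Ob realify Strip IsoS Mv)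
      (split : SplittingMonoids Mv) {ObΔ : Type} {N : ∀ v : (thetaIndex (pilotDataOfK T.D T.K)).V, v ∈ (thetaIndex (pilotDataOfK T.D T.K)).Vbad → Type}
      [∀ v h, Monoid (N v h)] (qData : QPilotData ObΔ N)
      (qK : ∀ v : (thetaIndex (pilotDataOfK T.D T.K)).V, v ∈ (thetaIndex (pilotDataOfK T.D T.K)).Vbad →
        Set ((logShellsDH (pilotDataOfK T.D T.K) (analyticLogv T.K)).StarPacket v)),
      ¬ Cor312Vol.PilotKummerCompatHull
          (LatticeSituation.ofShells (logShellsDH (pilotDataOfK T.D T.K) (analyticLogv T.K)) M archPk archSub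
            (summandPiecesPr (pilotDataOfK T.D T.K) (logvAnalytic_analyticLogv (F := T.K))).Adm
            (summandPiecesPr (pilotDataOfK T.D T.K) (logvAnalytic_analyticLogv (F := T.K))).logvol Ψ act Mmod region frobAdm frobLogvol frobΨ
            frobMmod unitImage ballImage thetaDiv)
          (settingPrVolSharp (pilotDataOfK T.D T.K) (logvAnalytic_analyticLogv (F := T.K)) M archPk archSub Ψ act Mmod region n lat sig split qData
            (exists_realising_qIdeles_pilotDataOfK T.D).choose (exists_realising_thetaIdeles_pilotDataOfK T.D).choose
            (exists_realising_qIdeles_pilotDataOfK T.D).choose_spec.1 (exists_realising_qIdeles_pilotDataOfK T.D).choose_spec.2.1)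
          (fun _ => Cor312.Setting.qRegion
            (settingPrVolSharp (pilotDataOfK T.D T.K) (logvAnalytic_analyticLogv (F := T.K)) M archPk archSub Ψ act Mmod region n lat sig split qData
              (exists_realising_qIdeles_pilotDataOfK T.D).choose (exists_realising_thetaIdeles_pilotDataOfK T.D).choose
              (exists_realising_qIdeles_pilotDataOfK T.D).choose_spec.1 (exists_realising_qIdeles_pilotDataOfK T.D).choose_spec.2.1)) qK := by
  rcases hl with rfl | rfl | rfl | rfl | rfl
  · exact GenuineK.not_pilotKummerCompatHull_chosen_frey99794037551104 (Or.inl rfl) T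
  · exact GenuineK.not_pilotKummerCompatHull_chosen_frey99794037551104 (Or.inr (Or.inl rfl)) T
  · exact GenuineK.not_pilotKummerCompatHull_chosen_frey99794037551104 (Or.inr (Or.inr rfl)) T
  · exact GenuineK.not_pilotKummerCompatHull_chosen_triple_of_ten_top isABCTriple_frey99794037551104 T ⟨223, by norm_num⟩ (by norm_num)
      (by norm_num) (by norm_num) (by norm_num) (by norm_num) 3 (by norm_num) (dvd_mul_of_dvd_left (dvd_mul_of_dvd_left (by norm_num) _) _)
      (by norm_num) (by norm_num) (by norm_num)
  · exact GenuineK.not_pilotKummerCompatHull_chosen_triple_of_ten_top isABCTriple_frey99794037551104 T ⟨223, by norm_num⟩ (by norm_num)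
      (by norm_num) (by norm_num) (by norm_num) (by norm_num) 3 (by norm_num) (dvd_mul_of_dvd_left (dvd_mul_of_dvd_left (by norm_num) _) _)
      (by norm_num) (by norm_num) (by norm_num)

end Summit.ABC.IUTFork.Conditional

end
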